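import Literature.AlgebraicGeometry.Hu2025.Statements.S07GammaSchemes.R109aGamma
import Literature.RingTheory.MvPolynomial.VariableIdeals
import Mathlib.RingTheory.MvPolynomial.Ideal
import HarnessLib

/-!
# Hu 2025 (arXiv:2507.21400v1), §7.1 Γ-schemes — KERNEL DISCHARGES of the three in-text claims of Def. 7.1/7.2
# typed in `S07GammaSchemes/R109aGamma.lean` (row 109, file a): `C57L24_holds`, `C57L63_holds`, `C57L61_holds`
# (+ `isGammaIrrelevant_iff_mem_gammaIdeal`), and of the standing sentences C57L29–L31 («Z_∅ = 𝐔 ∩ Gr^{3,E}»), C57L42–L43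
# («Z_Γ is the scheme-theoretic intersection of Gr^{3,E} with 𝐔_Γ»), C57L66–L67 («I_Γ is prime»); file
# `Literature/AlgebraicGeometry/Hu2025/Proofs/S07GammaSchemes/C57Claims.lean`.

**Honest framing.** Theorems about OUR typed definitions (`gammaIdeal`, `gammaWpIdeal`, `restrictGamma`, `IsGammaIrrelevant`,
the claims `C57L24`, `C57L61`, `C57L63`); they say that three elementary sentences of [Hu2025] p.128 hold AS TYPED, for every
field `𝔽`, every index type `σ`, every relation set `𝔉`, every `Γ`. Nothing else of the manuscript is asserted; it stays
under review. Provenance: res-type-016 (typer of record of row 109). Tree anchor: `Literature.RingTheory.MvPolynomial`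
(`isPrime_span_X_image`, `ker_aeval_ite_eq_span`: the ideal of a set of variables is the kernel of killing them, prime over a domain).
-/

namespace Literature.AlgebraicGeometry.Hu2025.Statements.S07GammaSchemes

open MvPolynomial

universe u

variable {σ : Type u} {𝔽 : Type u} [Field 𝔽]

/-- **C57L24 holds as typed** («Note that Z_Γ ≠ ∅ since 0 ∈ Z_Γ», given that the relations in `𝔉` vanish at the origin):
every element of `I_{℘,Γ} = I_Γ + ⟨𝔉⟩` vanishes at `0`, because evaluation at `0` is a ring map killing every generator.
[cite: Hu2025, Def. 7.1, chunk p0057 l.24; p.128 (unrefereed manuscript under adjudication — kernel discharge over the typed carriers, nothing else of the manuscript asserted)] -/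
theorem C57L24_holds :
    ∀ {σ 𝔽 : Type u} [Field 𝔽] (𝔉 : Set (MvPolynomial σ 𝔽)) (Γ : Set σ), C57L24 𝔉 Γ := by
  intro σ 𝔽 _ 𝔉 Γ h𝔉 G hG
  have hle : gammaWpIdeal 𝔉 Γ ≤ RingHom.ker (MvPolynomial.eval fun _ : σ => (0 : 𝔽)) := by
    refine sup_le ?_ ?_
    · refine Ideal.span_le.mpr ?_
      rintro _ ⟨u, -, rfl⟩
      simp [RingHom.mem_ker]
    · exact Ideal.span_le.mpr fun F hF => by simpa [RingHom.mem_ker] using h𝔉 F hF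
  exact (RingHom.mem_ker).mp (hle hG)

/-- **Γ-irrelevance is membership in `I_Γ`**: `F̄` is Γ-irrelevant (every term in `I_Γ`, Def. 7.2 as typed) iff `F̄ ∈ I_Γ`
(Mathlib: a polynomial lies in the monomial ideal `⟨x_u : u ∈ Γ⟩` iff every monomial of its support involves a variable of `Γ`).
[cite: Hu2025, Def. 7.2, chunk p0057 l.50–54, l.63; p.128 (unrefereed manuscript under adjudication — kernel discharge over the typed carriers, nothing else of the manuscript asserted)] -/
theorem isGammaIrrelevant_iff_mem_gammaIdeal (Γ : Set σ) (F : MvPolynomial σ 𝔽) :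
    IsGammaIrrelevant Γ F ↔ F ∈ gammaIdeal Γ := by
  unfold IsGammaIrrelevant gammaIdeal
  rw [mem_ideal_span_X_image]
  refine forall₂_congr fun d _ => ?_
  classical
  rw [mem_ideal_span_X_image, support_monomial, if_neg one_ne_zero]
  simp

/-- **C57L63 holds as typed** («F̄ is Γ-irrelevant if and only if every term of F̄ contains a member of Γ»; printed
reason C57L65–L68 «I_Γ is prime»). [cite: Hu2025, Def. 7.2, chunk p0057 l.63–68; p.128 (unrefereed manuscript under adjudication — kernel discharge over the typed carriers, nothing else of the manuscript asserted)] -/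
theorem C57L63_holds : ∀ {σ 𝔽 : Type u} [Field 𝔽] (Γ : Set σ) (F : MvPolynomial σ 𝔽), C57L63 Γ F := by
  intro σ 𝔽 _ Γ F
  unfold C57L63
  rw [isGammaIrrelevant_iff_mem_gammaIdeal, gammaIdeal, mem_ideal_span_X_image]

/-- `F̄|_Γ` kills the ideal `I_Γ`: the substitution `x_u ↦ 0 (u ∈ Γ)` sends every generator `x_u`, `u ∈ Γ`, to `0`.
[cite: Hu2025, chunk p0057 l.44–48; p.128 (unrefereed manuscript under adjudication — kernel discharge over the typed carriers, nothing else of the manuscript asserted)] -/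
theorem restrictGamma_eq_zero_of_mem_gammaIdeal (Γ : Set σ) {G : MvPolynomial σ 𝔽} (hG : G ∈ gammaIdeal Γ) :
    restrictGamma Γ G = 0 := by
  have hle : gammaIdeal Γ ≤ RingHom.ker (restrictGamma (𝔽 := 𝔽) Γ).toRingHom := by
    refine Ideal.span_le.mpr ?_
    rintro _ ⟨u, hu, rfl⟩
    rw [SetLike.mem_coe, RingHom.mem_ker]
    show restrictGamma Γ (X u) = 0
    simp [restrictGamma, hu]
  exact (RingHom.mem_ker).mp (hle hG)

/-- **C57L61 holds as typed** («If F̄ is Γ-irrelevant, then F̄|_Γ is identically zero along 𝐔_Γ»).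
[cite: Hu2025, chunk p0057 l.61; p.128 (unrefereed manuscript under adjudication — kernel discharge over the typed carriers, nothing else of the manuscript asserted)] -/
theorem C57L61_holds : ∀ {σ 𝔽 : Type u} [Field 𝔽] (Γ : Set σ) (F : MvPolynomial σ 𝔽), C57L61 Γ F :=
  fun Γ F hF => restrictGamma_eq_zero_of_mem_gammaIdeal Γ ((isGammaIrrelevant_iff_mem_gammaIdeal Γ F).mp hF)

/-- **C57L66–L67 holds as typed** («as I_Γ is prime (the coordinate subspace 𝐔_{m,Γ} is integral)»): the ideal `I_Γ`
generated by a set of variables is prime (tree `Literature.RingTheory.MvPolynomial.isPrime_span_X_image`: it is the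
kernel of `x_u ↦ 0 (u ∈ Γ)` onto the domain `𝔽[x]`).
[cite: Hu2025, chunk p0057 l.66–67; p.128 (unrefereed manuscript under adjudication — kernel discharge over the typed carriers, nothing else of the manuscript asserted)] -/
theorem isPrime_gammaIdeal (Γ : Set σ) : (gammaIdeal (𝔽 := 𝔽) Γ).IsPrime :=
  Literature.RingTheory.MvPolynomial.isPrime_span_X_image (R := 𝔽) Γ

/-- **`𝐔_Γ` is the coordinate subspace cut out by `I_Γ` (C57L33–L43): the kernel of the restriction `F̄ ↦ F̄|_Γ`
(`x_u ↦ 0`, `u ∈ Γ`) is exactly `I_Γ`** (tree `ker_aeval_ite_eq_span`).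
[cite: Hu2025, chunk p0057 l.33–48; p.128 (unrefereed manuscript under adjudication — kernel discharge over the typed carriers, nothing else of the manuscript asserted)] -/
theorem ker_restrictGamma (Γ : Set σ) :
    RingHom.ker (restrictGamma (𝔽 := 𝔽) Γ).toRingHom = gammaIdeal Γ := by
  classical
  have hfun : (fun u => @ite _ (u ∈ Γ) (Classical.dec _) (0 : MvPolynomial σ 𝔽) (X u)) =
      fun u => if u ∈ Γ then (0 : MvPolynomial σ 𝔽) else X u := by
    funext u
    by_cases hu : u ∈ Γ <;> simp [hu]
  unfold restrictGamma gammaIdeal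
  rw [hfun]
  exact Literature.RingTheory.MvPolynomial.ker_aeval_ite_eq_span (R := 𝔽) Γ

/-- `F̄|_Γ` is identically zero iff `F̄ ∈ I_Γ` iff `F̄` is Γ-irrelevant (C57L48 «F̄|_Γ can be identically zero», C57L61,
C57L63 together). [cite: Hu2025, chunk p0057 l.44–48, l.61–63; p.128 (unrefereed manuscript under adjudication — kernel discharge over the typed carriers, nothing else of the manuscript asserted)] -/
theorem restrictGamma_eq_zero_iff (Γ : Set σ) (F : MvPolynomial σ 𝔽) :
    restrictGamma Γ F = 0 ↔ IsGammaIrrelevant Γ F := by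
  rw [isGammaIrrelevant_iff_mem_gammaIdeal, ← ker_restrictGamma Γ, RingHom.mem_ker]
  rfl

/-- **C57L29–L31 as typed** («Take Γ = ∅. Then, I_{℘,∅} is the ideal generated by all the de-homogenized m-primary Plücker
relations. Thus, Z_∅ = 𝐔 ∩ Gr^{3,E}.»): `I_{℘,∅} = ⟨𝔉⟩`.
[cite: Hu2025, chunk p0057 l.29–31; p.128 (unrefereed manuscript under adjudication — kernel discharge over the typed carriers, nothing else of the manuscript asserted)] -/
theorem gammaWpIdeal_empty (𝔉 : Set (MvPolynomial σ 𝔽)) : gammaWpIdeal 𝔉 (∅ : Set σ) = Ideal.span 𝔉 := by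
  simp [gammaWpIdeal, gammaIdeal]

/-- **C57L42–L43 as typed** («Z_Γ is the scheme-theoretic intersection of Gr^{3,E} with the coordinate subspace 𝐔_Γ»):
at ideal level `I_{℘,Γ} = I_Γ + I_{℘,∅}` (sum of ideals = intersection of closed subschemes).
[cite: Hu2025, chunk p0057 l.42–43; p.128 (unrefereed manuscript under adjudication — kernel discharge over the typed carriers, nothing else of the manuscript asserted)] -/
theorem gammaWpIdeal_eq_sup (𝔉 : Set (MvPolynomial σ 𝔽)) (Γ : Set σ) :
    gammaWpIdeal 𝔉 Γ = gammaIdeal Γ ⊔ gammaWpIdeal 𝔉 (∅ : Set σ) := by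
  rw [gammaWpIdeal_empty]
  rfl

end Literature.AlgebraicGeometry.Hu2025.Statements.S07GammaSchemes
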